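import Summits.QuantumFields.BalabanUV.T4Continuum.Support.ShellMeasureAverageLipschitzChart
import Summits.QuantumFields.BalabanUV.T4Continuum.Support.ShellMeasureAverageAnalyticB7

/-!
# `T4Continuum.ShellMeasureAverageAnalyticB7Sharp` — WALL §3 W-d, ANALYTIC HALF WITHOUT SCHWARZ (instance): THE PRINTED
# BLOCK AVERAGE (2.4)∕[B7] (15) IN THE CHART IS ANALYTIC ON `‖B‖ < R♯ := 1∕(16(d+1)L)` WITH `‖Q̃‖ ≤ 1∕2` THERE —
# radius `176×` S49's `1∕(2816(d+1)L)`, same hypotheses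
(cell `pub-balaban`, sub-cell `t4`, spine estimate NE7c (node U5b); NE7c ROUND-2 crew `t4-ne7c-formalise-*`, seat
`b2b-balaban-t4-ne7c-formalise-leaf-06` gen 8, own-initiative OFFER «γ9″ THE W-d WINDOW WITHOUT SCHWARZ» (journal
`HOME/CLAIMS.log` l.20097, answering owner ruling R-ne7cp1-g34-4 (b)), file 2; imports file 1b
`ShellMeasureAverageLipschitzChart` and S49 f2 `ShellMeasureAverageAnalyticB7` (for the chart variable, `Qtilde_extend_eq`,
`sum_norm_weights_le_one`, `loops_small_gammaT`) ONLY; [folklore]; 0 `def`, 0 `def … : Prop`, 0 sorry, 0 citations)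

HONEST FRAMING.  Finite four-torus programme, rung (B)+1 only — NOT infinite volume, NOT a mass gap, NOT the Clay
problem, NOT summit progress; (B), `BetaPertHyp`, (B^μ) are not consumed.  NE7c (`T4IndicatorShell.ShellWeightBound`)
is NOT PRINTED and NOT PROVED; «NE7c ⇐ the named binders».  What is proved is an elementary property of the PRINTED
averaging operation [Balaban1985Averaging] (15) as DEFINED in the tree (`B12AverageCorridor267.Qtilde`, `loopW`, `pert`,
`Ustr`, `B12HOperator267.gammaT`), with OUR constants; the papers display no radius («it is an analytic function of B»,
[Balaban1987RG1] p. 267) — nothing printed is asserted, quantified or disputed.  NOTHING in the countdown moves; spine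
PROVED 0∕9.  HONEST DEPENDENCY (cell, verbatim): continuum YM on T⁴ ⇐ BetaPertH ∧ nine spine estimates (0/9 proved);
BetaPertH ⇐ (D1) ∧ (D4) ∧ CAP+tail; G-an2-4 gates asym, D1 and NE2/3/4.

WHAT IS PROVED (twins BY NAME of S49 f2's `analyticOnNhd_Qtilde(_gammaT)` ∕ `norm_Qtilde(_gammaT)_le`, same hypotheses,
sharper constants; S49∕S52∕S97 are untouched).
* §1 every transporter of the average is a TELESCOPED word (file 1a `LipWord`) of the perturbed configuration
  `pert (ext B) V`: one bond — weight `1`; `lineR … n` — weight `n`; `Ustr` — weight `L`; the printed contours `gammaT` —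
  weight `d·L`; the loop `W_x = loopW` — weight `2w_𝒯 + 2L` (mirrors S49 f2 §2 word for word).
* §2 **`numerics_sharp`** ([folklore] real arithmetic): with `w ≥ 4w_T > 0`, `0 ≤ ε ≤ 1∕8`, `R♯ = 1∕(8w)`: the loop
  regime `ε + (e^{1∕8} − 1) < 1`; the quotient bound of file 1b at `σ₀ = ε∕(1−ε)`, `α = (e^{1∕8} − 1)∕(2 − ε − e^{1∕8})`,
  `w_T R♯ ≤ 1∕32` is `≤ 19∕50` (`e^{1∕8} ≤ 8∕7`, `α ≤ 8∕41`, `e^{α} ≤ 41∕33`, `e^{1∕32} ≤ 32∕31`,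
  `e^{2∕7} ≤ 4111∕3087`: `(4111∕3087)·(289∕1023) < 0.3763`); and `−ln(1 − 19∕50) = ln(50∕31) ≤ 1∕2` (`e^{1∕2} ≥ 13∕8`).
* §3 for ANY block-local transporter family `𝒯` whose transporters are `LipWord`s of weight `w_𝒯 ≥ L`, unit-bounded `V`
  and block loops with `‖W_x(V) − 1‖ ≤ ε ≤ 1∕8` on `B(c₋)`: with `w := 2w_𝒯 + 2L`, **`analyticOnNhd_Qtilde_sharp`** —
  `B ↦ Q̃_V(ext B)(c)` is `AnalyticOnNhd ℂ` on `ball 0 (1∕(8w))` — and **`norm_Qtilde_le_sharp`** — `‖Q̃_V(ext B)(c)‖ ≤ 1∕2`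
  there (file 1b's `chartAverage_analyticOnNhd_sharp` ∕ `norm_chartAverage_le_sharp` fed by §1, §2).
* §4 THE PRINTED INSTANCE [B7] (15), `𝒯 = gammaT` (`w_𝒯 = dL ≥ L` since a coarse bond `c` exists only for `d ≥ 1`):
  **`analyticOnNhd_Qtilde_gammaT_sharp`** on `ball 0 (1∕(16·(d+1)·L))` and **`norm_Qtilde_gammaT_le_sharp`** (`≤ 1∕2`
  there), hypotheses EXACTLY those of S49 f2 §5 (= `h_paragraph_p267_gammaT`'s: `hW` off-axis, `hV`, `hV'`, `0 ≤ ε ≤ 1∕8`).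
CONSEQUENCE (file 3, `ShellMeasureLinearizedGammaTEndSharp`): S52's (LR)_j END re-fired at `(R, M_Q) := (R♯, ½)`; on
`T⁴` at `L = 2` the chart window grows from `8.70·10⁻¹²` (S97) to `≈ 5.35·10⁻⁷`.  NOT HERE: `fderiv = LQ` (S48), reality
(S47), the junction (S46); the deeper lever (a direct second-variation bound replacing Cauchy's `Mq = 2M∕R²` in S46).
-/

noncomputable section

open NormedSpace Metric Set Finset

namespace Summit.QuantumFields.BalabanUV.T4Continuum.ShellMeasureAverageAnalyticB7Sharp

open Literature.MathematicalPhysics.QuantumFieldTheory.Balaban1983to89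
open Literature.MathematicalPhysics.QuantumLattice (ZdEdge blockMap blockBase blockSites)
open B7BlockGeometry (qppBonds)
open B7Eq61Linearization (pathProd lineR)
open B12HOperator267 (gammaT gammaPt)
open B12AverageCorridor267 (expU pert pert_apply Ustr loopW Qtilde offAxis)
open MatrixLog (mlog)
open ShellMeasureAverageAnalytic (ExpWord)
open ShellMeasureAverageLipschitz (LipWord)
open ShellMeasureAverageLipschitzChart
open ShellMeasureAverageAnalyticB7 (extend_val extend_of_not_mem pert_extend_zero Qtilde_extend_eq
  sum_norm_weights_le_one loops_small_gammaT)

variable {d : ℕ} {𝔸 : Type*} [NormedRing 𝔸] [NormedAlgebra ℂ 𝔸] [CompleteSpace 𝔸] [NormOneClass 𝔸]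
variable {L : ℕ} {c : ZdEdge d} {V : ZdEdge d → 𝔸ˣ}

/-! ## §1 The transporters of the average are TELESCOPED words of the perturbed configuration -/

/-- ONE BOND: `B ↦ e^{iB(b)}V(b)` (`B(b) := 0` off the two blocks) is a `LipWord` of weight `1`. [folklore] -/
theorem lipWord_pert (hV : ∀ b, ‖((V b : 𝔸ˣ) : 𝔸)‖ ≤ 1) (hV' : ∀ b, ‖(((V b)⁻¹ : 𝔸ˣ) : 𝔸)‖ ≤ 1) (b : ZdEdge d) :
    LipWord (fun B : ↥(qppBonds L c) → 𝔸 => pert (Function.extend Subtype.val B (0 : ZdEdge d → 𝔸)) V b) 1 := by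
  by_cases hb : b ∈ qppBonds L c
  · have h : (fun B : ↥(qppBonds L c) → 𝔸 => pert (Function.extend Subtype.val B (0 : ZdEdge d → 𝔸)) V b)
        = fun B => expU (Complex.I • (ContinuousLinearMap.proj (R := ℂ) (φ := fun _ : ↥(qppBonds L c) => 𝔸)
            ⟨b, hb⟩) B) * V b := by
      funext B
      rw [pert_apply, ContinuousLinearMap.proj_apply, ← extend_val B ⟨b, hb⟩]
    rw [h]
    exact LipWord.expFactor _ (fun B => norm_le_pi_norm B ⟨b, hb⟩) (hV b) (hV' b)
  · have h : (fun B : ↥(qppBonds L c) → 𝔸 => pert (Function.extend Subtype.val B (0 : ZdEdge d → 𝔸)) V b)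
        = fun _ => V b := by
      funext B
      rw [pert_apply, extend_of_not_mem B hb, smul_zero, B12AverageCorridor267.expU_zero, one_mul]
    rw [h]
    exact (LipWord.const (hV b) (hV' b)).mono zero_le_one

/-- A STRAIGHT SEGMENT of `n` bonds (`lineR`): weight `n`. [folklore] -/
theorem lipWord_lineR (hV : ∀ b, ‖((V b : 𝔸ˣ) : 𝔸)‖ ≤ 1) (hV' : ∀ b, ‖(((V b)⁻¹ : 𝔸ˣ) : 𝔸)‖ ≤ 1)
    (x : Fin d → ℤ) (μ : Fin d) (n : ℕ) :
    LipWord (fun B : ↥(qppBonds L c) → 𝔸 =>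
      lineR (pert (Function.extend Subtype.val B (0 : ZdEdge d → 𝔸)) V) x μ n) n := by
  have h := LipWord.pathProd (E := ↥(qppBonds L c) → 𝔸)
    (G := fun B t => pert (Function.extend Subtype.val B (0 : ZdEdge d → 𝔸)) V (x + Pi.single μ (t : ℤ), μ))
    (w := 1) (fun t => lipWord_pert hV hV' _) n
  rw [mul_one] at h
  exact h

/-- THE COARSE-BOND HOLONOMY `U(c′)` (`Ustr`, `L` bonds): weight `L`. [folklore] -/
theorem lipWord_Ustr (hV : ∀ b, ‖((V b : 𝔸ˣ) : 𝔸)‖ ≤ 1) (hV' : ∀ b, ‖(((V b)⁻¹ : 𝔸ˣ) : 𝔸)‖ ≤ 1) (c' : ZdEdge d) :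
    LipWord (fun B : ↥(qppBonds L c) → 𝔸 => Ustr L (pert (Function.extend Subtype.val B (0 : ZdEdge d → 𝔸)) V) c')
      L :=
  lipWord_lineR hV hV' _ _ L

/-- THE PRINTED CONTOURS `Γ_{y,x}` (`gammaT`: `d` straight pieces of `< L` bonds each): weight `d·L`. [folklore] -/
theorem lipWord_gammaT (hL : 0 < L) (hV : ∀ b, ‖((V b : 𝔸ˣ) : 𝔸)‖ ≤ 1) (hV' : ∀ b, ‖(((V b)⁻¹ : 𝔸ˣ) : 𝔸)‖ ≤ 1)
    (x : Fin d → ℤ) :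
    LipWord (fun B : ↥(qppBonds L c) → 𝔸 => gammaT L (pert (Function.extend Subtype.val B (0 : ZdEdge d → 𝔸)) V) x)
      (d * L) := by
  have hpiece : ∀ i ∈ (List.finRange d).reverse, LipWord (fun B : ↥(qppBonds L c) → 𝔸 =>
      lineR (pert (Function.extend Subtype.val B (0 : ZdEdge d → 𝔸)) V) (gammaPt (blockBase L (blockMap L x)) x i) i
        (x i - blockBase L (blockMap L x) i).toNat) ((fun _ => (L : ℝ)) i) := by
    intro i _
    refine (lipWord_lineR hV hV' _ _ _).mono ?_
    have hL' : (0 : ℤ) < L := by exact_mod_cast hL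
    have hmod : x i - blockBase L (blockMap L x) i = x i % (L : ℤ) := by
      simp only [blockBase, blockMap]; rw [Int.emod_def]
    have h0 : 0 ≤ x i - blockBase L (blockMap L x) i := by rw [hmod]; exact Int.emod_nonneg _ hL'.ne'
    have h1 : x i - blockBase L (blockMap L x) i < L := by rw [hmod]; exact Int.emod_lt_of_pos _ hL'
    have : ((x i - blockBase L (blockMap L x) i).toNat : ℝ) ≤ L := by
      have h2 : ((x i - blockBase L (blockMap L x) i).toNat : ℤ) ≤ L := by
        rw [Int.toNat_of_nonneg h0]; exact h1.le
      exact_mod_cast h2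
    exact this
  have h := LipWord.listProd (E := ↥(qppBonds L c) → 𝔸)
    (fun i B => lineR (pert (Function.extend Subtype.val B (0 : ZdEdge d → 𝔸)) V)
      (gammaPt (blockBase L (blockMap L x)) x i) i (x i - blockBase L (blockMap L x) i).toNat)
    (fun _ => (L : ℝ)) (List.finRange d).reverse hpiece
  have hsum : (((List.finRange d).reverse).map fun _ : Fin d => (L : ℝ)).sum = d * L := by
    rw [List.map_const', List.sum_replicate, List.length_reverse, List.length_finRange, nsmul_eq_mul]
  rw [hsum] at h
  exact h

variable {𝒯 : (ZdEdge d → 𝔸ˣ) → (Fin d → ℤ) → 𝔸ˣ} {w𝒯 : ℝ}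

/-- THE LOOP `W_x = 𝒯(x)·U([x,x′])·𝒯(x′)⁻¹·U(c)⁻¹` (`loopW`): weight `2w_𝒯 + 2L`. [folklore] -/
theorem lipWord_loopW (hV : ∀ b, ‖((V b : 𝔸ˣ) : 𝔸)‖ ≤ 1) (hV' : ∀ b, ‖(((V b)⁻¹ : 𝔸ˣ) : 𝔸)‖ ≤ 1)
    (h𝒯 : ∀ x, LipWord (fun B : ↥(qppBonds L c) → 𝔸 =>
      𝒯 (pert (Function.extend Subtype.val B (0 : ZdEdge d → 𝔸)) V) x) w𝒯) (x : Fin d → ℤ) :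
    LipWord (fun B : ↥(qppBonds L c) → 𝔸 =>
      loopW L 𝒯 (pert (Function.extend Subtype.val B (0 : ZdEdge d → 𝔸)) V) c x) (2 * w𝒯 + 2 * L) := by
  have h := (((h𝒯 x).mul (lipWord_lineR hV hV' x c.2 L)).mul (h𝒯 (x + Pi.single c.2 (L : ℤ))).inv).mul
    (lipWord_Ustr hV hV' c).inv
  exact h.mono (le_of_eq (by ring))

/-! ## §2 The numerics of the sharp radius `R♯ = 1∕(8w)` -/

/-- `e^x ≤ 1∕(1 − x)`-type bound, packaged: `0 ≤ x ≤ q < 1` ⟹ `e^x ≤ 1∕(1 − q)`. [folklore] -/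
theorem exp_le_inv_one_sub {x q : ℝ} (h0 : 0 ≤ x) (hx : x ≤ q) (hq : q < 1) : Real.exp x ≤ 1 / (1 - q) :=
  (Real.exp_le_exp.2 hx).trans (Real.exp_bound_div_one_sub_of_interval ((h0.trans hx)) hq)

/-- `e^{2∕7} ≤ 4111∕3087` (third-order Taylor bound `Real.exp_bound'`). [folklore] -/
theorem exp_two_sevenths_le : Real.exp (2 / 7) ≤ 4111 / 3087 := by
  have h := Real.exp_bound' (x := 2 / 7) (by norm_num) (by norm_num) (n := 3) (by norm_num)
  refine h.trans ?_
  simp only [Finset.sum_range_succ, Finset.sum_range_zero, Nat.factorial]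
  norm_num

/-- `ln(50∕31) ≤ 1∕2` (`50∕31 ≤ 13∕8 ≤ e^{1∕2}`, `Real.quadratic_le_exp_of_nonneg`). [folklore] -/
theorem neg_log_le_half : -Real.log (1 - 19 / 50) ≤ 1 / 2 := by
  have h1 : (1 : ℝ) - 19 / 50 = (50 / 31)⁻¹ := by norm_num
  rw [h1, Real.log_inv, neg_neg, Real.log_le_iff_le_exp (by norm_num)]
  have h2 := Real.quadratic_le_exp_of_nonneg (x := 1 / 2) (by norm_num)
  exact le_trans (by norm_num) h2

/-- **THE NUMERICS OF `R♯`** ([folklore] real arithmetic): for `0 < w`, `0 ≤ w_T`, `4w_T ≤ w`, `0 ≤ ε ≤ 1∕8`, at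
`R♯ = 1∕(8w)` (so `wR♯ = 1∕8`, `w_T R♯ ≤ 1∕32`): (i) the loop regime `ε + (e^{1∕8} − 1) < 1`; (ii) file 1b's quotient bound
at `σ₀ = ε∕(1−ε)`, `α = (e^{1∕8} − 1)∕(1 − (ε + (e^{1∕8} − 1)))` is `≤ 19∕50`; (iii) `−ln(1 − 19∕50) ≤ 1∕2`. [folklore] -/
theorem numerics_sharp {ε w wT : ℝ} (hε0 : 0 ≤ ε) (hε : ε ≤ 1 / 8) (hw : 0 < w) (hwT0 : 0 ≤ wT) (hwT : 4 * wT ≤ w) :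
    ε + (Real.exp (w * (1 / (8 * w))) - 1) < 1 ∧
    Real.exp (2 * (ε / (1 - ε))) *
        ((Real.exp (w * (1 / (8 * w))) - 1) / (1 - (ε + (Real.exp (w * (1 / (8 * w))) - 1))) *
          Real.exp ((Real.exp (w * (1 / (8 * w))) - 1) / (1 - (ε + (Real.exp (w * (1 / (8 * w))) - 1)))) *
          Real.exp (wT * (1 / (8 * w))) + (Real.exp (wT * (1 / (8 * w))) - 1)) ≤ 19 / 50 ∧
    -Real.log (1 - 19 / 50) ≤ 1 / 2 := by
  have hwR : w * (1 / (8 * w)) = 1 / 8 := by field_simp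
  rw [hwR]
  -- `U := e^{1/8} − 1 ∈ [0, 1/7]`
  have hU1 : Real.exp (1 / 8) ≤ 8 / 7 := (exp_le_inv_one_sub (by norm_num) le_rfl (by norm_num)).trans (by norm_num)
  have hU0 : 1 ≤ Real.exp (1 / 8 : ℝ) := Real.one_le_exp (by norm_num)
  set U := Real.exp (1 / 8 : ℝ) - 1 with hU
  have hU0' : 0 ≤ U := by rw [hU]; linarith
  have hU1' : U ≤ 1 / 7 := by rw [hU]; linarith
  -- the denominator `1 − (ε + U) ≥ 41/56`
  have hden : 41 / 56 ≤ 1 - (ε + U) := by linarith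
  have hden0 : 0 < 1 - (ε + U) := by linarith
  -- `α ≤ 8/41`
  set α := U / (1 - (ε + U)) with hα
  have hα0 : 0 ≤ α := div_nonneg hU0' hden0.le
  have hα1 : α ≤ 8 / 41 := by
    rw [hα, div_le_iff₀ hden0]
    nlinarith
  have heα : Real.exp α ≤ 41 / 33 := (exp_le_inv_one_sub hα0 hα1 (by norm_num)).trans (by norm_num)
  -- `t := w_T R♯ ≤ 1/32`
  have ht0 : 0 ≤ wT * (1 / (8 * w)) := by positivity
  have ht1 : wT * (1 / (8 * w)) ≤ 1 / 32 := by
    rw [mul_one_div, div_le_iff₀ (by positivity)]; nlinarith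
  have het : Real.exp (wT * (1 / (8 * w))) ≤ 32 / 31 := (exp_le_inv_one_sub ht0 ht1 (by norm_num)).trans (by norm_num)
  have het0 : 0 ≤ Real.exp (wT * (1 / (8 * w))) - 1 := by linarith [Real.one_le_exp ht0]
  -- `e^{2σ₀} ≤ 4111/3087`
  have hσ : ε / (1 - ε) ≤ 1 / 7 := by
    rw [div_le_iff₀ (by linarith)]; linarith
  have hσ0 : 0 ≤ ε / (1 - ε) := div_nonneg hε0 (by linarith)
  have heσ : Real.exp (2 * (ε / (1 - ε))) ≤ 4111 / 3087 :=
    (Real.exp_le_exp.2 (by linarith : 2 * (ε / (1 - ε)) ≤ 2 / 7)).trans exp_two_sevenths_le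
  refine ⟨by linarith, ?_, neg_log_le_half⟩
  -- combine
  have hin : α * Real.exp α * Real.exp (wT * (1 / (8 * w))) + (Real.exp (wT * (1 / (8 * w))) - 1)
      ≤ 8 / 41 * (41 / 33) * (32 / 31) + (32 / 31 - 1) := by
    have h1 : α * Real.exp α * Real.exp (wT * (1 / (8 * w))) ≤ 8 / 41 * (41 / 33) * (32 / 31) :=
      mul_le_mul (mul_le_mul hα1 heα (Real.exp_pos _).le (by norm_num)) het (Real.exp_pos _).le (by norm_num)
    linarith
  have hin0 : 0 ≤ α * Real.exp α * Real.exp (wT * (1 / (8 * w))) + (Real.exp (wT * (1 / (8 * w))) - 1) :=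
    add_nonneg (by positivity) het0
  calc Real.exp (2 * (ε / (1 - ε))) *
        (α * Real.exp α * Real.exp (wT * (1 / (8 * w))) + (Real.exp (wT * (1 / (8 * w))) - 1))
      ≤ 4111 / 3087 * (8 / 41 * (41 / 33) * (32 / 31) + (32 / 31 - 1)) :=
        mul_le_mul heσ hin hin0 (by norm_num)
    _ ≤ 19 / 50 := by norm_num

/-! ## §3 The sharp facts for a block-local transporter family -/

section Family

variable (hL : 0 < L) (hV : ∀ b, ‖((V b : 𝔸ˣ) : 𝔸)‖ ≤ 1) (hV' : ∀ b, ‖(((V b)⁻¹ : 𝔸ˣ) : 𝔸)‖ ≤ 1)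
  (hLw : (L : ℝ) ≤ w𝒯)
  (h𝒯 : ∀ x, LipWord (fun B : ↥(qppBonds L c) → 𝔸 =>
    𝒯 (pert (Function.extend Subtype.val B (0 : ZdEdge d → 𝔸)) V) x) w𝒯)
  {ε : ℝ} (hε0 : 0 ≤ ε) (hε : ε ≤ 1 / 8)
  (hW : ∀ x ∈ blockSites L c.1, ‖((loopW L 𝒯 V c x : 𝔸ˣ) : 𝔸) - 1‖ ≤ ε)
include hL hV hV' hLw h𝒯 hε0 hε hW

omit [NormOneClass 𝔸] hL hV hV' hLw h𝒯 hε0 hε in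
/-- The loops at `B = 0` are the background loops, `ε`-close to `1`. [folklore] -/
theorem loops_at_zero :
    ∀ x ∈ blockSites L c.1, ‖(((fun B : ↥(qppBonds L c) → 𝔸 =>
      loopW L 𝒯 (pert (Function.extend Subtype.val B (0 : ZdEdge d → 𝔸)) V) c x) 0 : 𝔸ˣ) : 𝔸) - 1‖ ≤ ε :=
  fun x hx => by simp only [pert_extend_zero]; exact hW x hx

/-- **THE AVERAGE IN THE CHART IS ANALYTIC** on `ball 0 (1∕(8·(2w_𝒯 + 2L)))` (sharp form). [folklore] -/
theorem analyticOnNhd_Qtilde_sharp :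
    AnalyticOnNhd ℂ (fun B : ↥(qppBonds L c) → 𝔸 => Qtilde L 𝒯 V (Function.extend Subtype.val B (0 : ZdEdge d → 𝔸)) c)
      (ball 0 (1 / (8 * (2 * w𝒯 + 2 * L)))) := by
  have hLr : (1 : ℝ) ≤ L := by exact_mod_cast hL
  have hw0 : 0 < 2 * w𝒯 + 2 * L := by linarith
  obtain ⟨hr, hf, -⟩ := numerics_sharp (wT := L) hε0 hε hw0 (by linarith) (by linarith)
  have hloops := fun x (_ : x ∈ blockSites L c.1) => lipWord_loopW (c := c) hV hV' h𝒯 x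
  have hε' := loops_at_zero (c := c) hW
  have key : (fun B : ↥(qppBonds L c) → 𝔸 => Qtilde L 𝒯 V (Function.extend Subtype.val B (0 : ZdEdge d → 𝔸)) c) = _ :=
    funext fun B => Qtilde_extend_eq (L := L) (𝒯 := 𝒯) (c := c) V B
  rw [key]
  exact chartAverage_analyticOnNhd_sharp (lipWord_Ustr hV hV' c)
    (fun B hB => analyticAt_exponent_sharp hloops hε' hr hB)
    (norm_exponent_zero_le (s := blockSites L c.1) (a := fun _ => (((L : ℂ) ^ d)⁻¹ : ℂ))
      (W := fun x (B : ↥(qppBonds L c) → 𝔸) =>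
        loopW L 𝒯 (pert (Function.extend Subtype.val B (0 : ZdEdge d → 𝔸)) V) c x)
      hε' hε0 (by linarith) (sum_norm_weights_le_one hL c.1))
    (fun B hB => norm_exponent_sub_le_of_ball hloops hε' hr hw0.le (sum_norm_weights_le_one hL c.1) hB)
    hf (by norm_num)

/-- **THE AVERAGE IN THE CHART IS BOUNDED BY `1∕2`** on that ball (sharp form). [folklore] -/
theorem norm_Qtilde_le_sharp {B : ↥(qppBonds L c) → 𝔸} (hB : ‖B‖ < 1 / (8 * (2 * w𝒯 + 2 * L))) :
    ‖Qtilde L 𝒯 V (Function.extend Subtype.val B (0 : ZdEdge d → 𝔸)) c‖ ≤ 1 / 2 := by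
  have hLr : (1 : ℝ) ≤ L := by exact_mod_cast hL
  have hw0 : 0 < 2 * w𝒯 + 2 * L := by linarith
  obtain ⟨hr, hf, hlog⟩ := numerics_sharp (wT := L) hε0 hε hw0 (by linarith) (by linarith)
  have hloops := fun x (_ : x ∈ blockSites L c.1) => lipWord_loopW (c := c) hV hV' h𝒯 x
  have hε' := loops_at_zero (c := c) hW
  rw [Qtilde_extend_eq]
  exact (norm_chartAverage_le_sharp
    (S := fun B : ↥(qppBonds L c) → 𝔸 => ∑ x ∈ blockSites L c.1, (((L : ℂ) ^ d)⁻¹ : ℂ) •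
      mlog ((loopW L 𝒯 (pert (Function.extend Subtype.val B (0 : ZdEdge d → 𝔸)) V) c x : 𝔸ˣ) : 𝔸))
    (lipWord_Ustr hV hV' c)
    (norm_exponent_zero_le (s := blockSites L c.1) (a := fun _ => (((L : ℂ) ^ d)⁻¹ : ℂ))
      (W := fun x (B : ↥(qppBonds L c) → 𝔸) =>
        loopW L 𝒯 (pert (Function.extend Subtype.val B (0 : ZdEdge d → 𝔸)) V) c x)
      hε' hε0 (by linarith) (sum_norm_weights_le_one hL c.1))
    (fun B hB => norm_exponent_sub_le_of_ball hloops hε' hr hw0.le (sum_norm_weights_le_one hL c.1) hB)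
    hf (by norm_num) hB).trans hlog

end Family

/-! ## §4 The printed instance [B7] (15): `𝒯 = gammaT`, `R♯ = 1∕(16(d+1)L)` -/

section GammaT

variable (hL : 0 < L) (hV : ∀ b, ‖((V b : 𝔸ˣ) : 𝔸)‖ ≤ 1) (hV' : ∀ b, ‖(((V b)⁻¹ : 𝔸ˣ) : 𝔸)‖ ≤ 1)
  {ε : ℝ} (hε0 : 0 ≤ ε) (hε : ε ≤ 1 / 8)
  (hW : ∀ x ∈ offAxis L c,
    ‖((loopW L (fun U : ZdEdge d → 𝔸ˣ => gammaT L U) V c x : 𝔸ˣ) : 𝔸) - 1‖ ≤ ε)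
include hL hV hV' hε0 hε hW

omit [NormedAlgebra ℂ 𝔸] [CompleteSpace 𝔸] [NormOneClass 𝔸] hV hV' hε0 hε hW hL in
/-- A coarse bond exists only in positive dimension; hence `L ≤ d·L`. [folklore] -/
theorem cast_le_mul_of_edge (c : ZdEdge d) : (L : ℝ) ≤ (d : ℝ) * L := by
  have hd : 1 ≤ d := Fin.pos c.2
  have hd' : (1 : ℝ) ≤ d := by exact_mod_cast hd
  have hL0 : (0 : ℝ) ≤ L := Nat.cast_nonneg L
  nlinarith

/-- **[B7] (15): THE PRINTED BLOCK AVERAGE IN THE CHART IS ANALYTIC ON `ball 0 (1∕(16·(d+1)·L))`** of the bond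
functions on `B(c₋) ∪ B(c₊)`, for every unit-bounded background with `ε`-regular off-axis block loops (`0 ≤ ε ≤ 1∕8`;
hypotheses exactly those of S49 f2's `analyticOnNhd_Qtilde_gammaT`, radius `176×` larger). [folklore] -/
theorem analyticOnNhd_Qtilde_gammaT_sharp :
    AnalyticOnNhd ℂ (fun B : ↥(qppBonds L c) → 𝔸 =>
        Qtilde L (fun U : ZdEdge d → 𝔸ˣ => gammaT L U) V (Function.extend Subtype.val B (0 : ZdEdge d → 𝔸)) c)
      (ball 0 (1 / (16 * ((d : ℝ) + 1) * L))) := by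
  have h := analyticOnNhd_Qtilde_sharp (𝒯 := fun U : ZdEdge d → 𝔸ˣ => gammaT L U) hL hV hV' (cast_le_mul_of_edge c)
    (lipWord_gammaT hL hV hV') hε0 hε (loops_small_gammaT hL hε0 hW)
  have hr : (1 : ℝ) / (8 * (2 * (d * L) + 2 * L)) = 1 / (16 * ((d : ℝ) + 1) * L) := by
    congr 1; ring
  rwa [hr] at h

/-- **[B7] (15): … AND BOUNDED BY `1∕2`** there. [folklore] -/
theorem norm_Qtilde_gammaT_le_sharp {B : ↥(qppBonds L c) → 𝔸} (hB : ‖B‖ < 1 / (16 * ((d : ℝ) + 1) * L)) :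
    ‖Qtilde L (fun U : ZdEdge d → 𝔸ˣ => gammaT L U) V (Function.extend Subtype.val B (0 : ZdEdge d → 𝔸)) c‖
      ≤ 1 / 2 := by
  have hr : (8 : ℝ) * (2 * (d * L) + 2 * L) = 16 * ((d : ℝ) + 1) * L := by ring
  exact norm_Qtilde_le_sharp (𝒯 := fun U : ZdEdge d → 𝔸ˣ => gammaT L U) hL hV hV' (cast_le_mul_of_edge c)
    (lipWord_gammaT hL hV hV') hε0 hε (loops_small_gammaT hL hε0 hW) (B := B) (by rwa [hr])

end GammaT

end Summit.QuantumFields.BalabanUV.T4Continuum.ShellMeasureAverageAnalyticB7Sharp
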